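import Literature.AlgebraicGeometry.GroupSchemes.InfinitesimalToUnramifiedTrivial
import Literature.AlgebraicGeometry.GroupSchemes.EtaleOfTrivialUnitComponent
import Literature.AlgebraicGeometry.Morphisms.ClosedImmersionOfEqualRank
import Literature.AlgebraicGeometry.Morphisms.FiniteFlatRankComp
import Mathlib.AlgebraicGeometry.Morphisms.Etale
import HarnessLib

/-!
# An étale closed subgroup of complementary rank splits off the unit component: `H × G⁰ ≅ G` ([Tate1997FiniteFlatGroupSchemes] (3.7))

Topic `Literature/AlgebraicGeometry/GroupSchemes`; namespace `Literature.AlgebraicGeometry.GroupSchemes`.  THEOREMS ONLY (no definition, no named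
fact, no instance, no notation, no `sorry`).  Cell `hodgecm-mathlib` (D-0151 ∕ D-0183 FLOOR 0), P6 «MOD programme», organ **(o-c3j)** of F0P6c-plan (g0)'s
DICT constructor list (2026-09-01 14:33Z): «AN ÉTALE SUBGROUP OF COMPLEMENTARY RANK SPLITS OFF THE UNIT COMPONENT» — the input of the
`PointDictionary` field (c3b) in degree currency: with `G = 𝒜_x̄[𝔴]` (rank `q²`), `G₀ = ker F` (rank `q`), `H` an étale line (rank `q`):
`H × ker F ≅ 𝒜[𝔴]`, so the isogeny `𝒜 → 𝒜⁄H → (𝒜⁄H)^{(q)}` IS the quotient by `𝒜[𝔴]`.  `--supports stmt-HodgeConjecture-24832`; COUNT-NEUTRAL: HC_CM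
is proved only modulo the printed citations until rung 0 closes.

THE PRINT.  [Tate1997FiniteFlatGroupSchemes] (3.7): over a henselian local base a finite flat group scheme has the connected–étale sequence
`0 → G⁰ → G → G^ét → 0`, and «over a perfect field the sequence splits canonically: `G = G⁰ × G_red`»; the finite-level statement used here: a
closed ÉTALE subgroup `H` with `rk H · rk G⁰ = rk G` maps isomorphically onto `G^ét`, i.e. multiplication `H × G⁰ → G` is an isomorphism
(commutative `G`).  [AtiyahMacdonald1969] Prop. 8.1 ∕ 8.3: an Artin ring has finitely many primes, all maximal (finite `k`-schemes are discrete).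

* §1 `discreteTopology_of_isFinite`, **`subsingleton_of_isFinite_of_connectedSpace`** — a connected scheme finite over a field has ONE point
  (pattern of ★ B-p17 `isClosed_singleton_of_isFinite`: Artinian coordinate ring ⇒ discrete).
* §2 **`eq_one_of_comp_eq_comp`** — `d₁ : T → H`, `d₂ : T → G₀` with `d₁ ≫ i = d₂ ≫ j` ⇒ `d₁ = 1`: the image of `d₁` lies over the unit point
  (`G₀` one point, `i` injective, `η ≫ i = η = η ≫ j`), so ★ B-p08 (E1′) `eq_toUnit_comp_of_range_subset` (unramified `H`) applies — no group law on
  the kernel is needed;  **`isIso_tensorHom_comp_mul_of_etale`** — the splitting `IsIso ((i ⊗ₘ j) ≫ μ[G])`: monomorphism by the two-coordinate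
  computation in the commutative group `(T ⟶ G)` (Mathlib `lift_map`, `Hom.mul_def`, `MonObj.mul_comp`, `GrpObj.inv_comp`, `group`), then
  `Mono m.left` (Mathlib `Over.mono_left_of_mono`), finite (`HasOfPostcompProperty @IsFinite @IsSeparated`), closed immersion (Mathlib
  `IsClosedImmersion.iff_isFinite_and_mono`), flat over the field (Mathlib: one-point integral base), equal ranks (★ `finrank_tensorObj_hom`) ⇒ iso
  (★ o-c2c `Over.isIso_of_isClosedImmersion_of_finrank_eq`).

NOT HERE: `IsMonHom` of the splitting map (immediate from Mathlib's instances `IsMonHom (f ⊗ₘ g)`, `IsMonHom μ[G]` for commutative `G`, when a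
consumer wants it), the identification `H ≅ G^ét`, non-commutative `G`.

## References
* [Tate1997FiniteFlatGroupSchemes] J. Tate, *Finite flat group schemes*, in *Modular Forms and Fermat's Last Theorem* (Springer 1997) — (3.7)
  (connected–étale sequence; splitting over a perfect field).
* [AtiyahMacdonald1969] M. F. Atiyah, I. G. Macdonald, *Introduction to Commutative Algebra* (1969) — Prop. 8.1, 8.3 (p. 89).
-/

noncomputable section

-- Mathlib's `Over`/pull-back API is stated across semireducible wrappers (as in the ★ `GroupSchemes/*` files).
set_option backward.isDefEq.respectTransparency false

universe u

open CategoryTheory CategoryTheory.Limits AlgebraicGeometry MonoidalCategory CartesianMonoidalCategory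
open scoped MonObj

namespace Literature.AlgebraicGeometry.GroupSchemes

variable {k : Type u} [Field k]

/-! ## §1 A connected scheme finite over a field has exactly one point -/

/-- A scheme FINITE over a field has the discrete topology (its coordinate ring is Artinian; pattern of ★
`isClosed_singleton_of_isFinite`). [cite: AtiyahMacdonald1969, Prop. 8.1 and Prop. 8.3 (p. 89)] -/
theorem discreteTopology_of_isFinite {X : Scheme.{u}} (f : X ⟶ Spec (.of k)) [IsFinite f] : DiscreteTopology ↥X := by
  haveI : IsAffine X := isAffine_of_isAffineHom f
  letI := (Motives.algebraMapΓ f).hom.toAlgebra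
  haveI : IsFinite (Over.mk f : Over (Spec (.of k))).hom := inferInstanceAs (IsFinite f)
  haveI : Module.Finite k Γ(X, ⊤) := AffineGroupScheme.Alg.moduleFinite (Over.mk f)
  haveI : IsArtinianRing Γ(X, ⊤) := IsArtinianRing.of_finite k Γ(X, ⊤)
  haveI : DiscreteTopology ↥(Spec Γ(X, ⊤)) := inferInstanceAs (DiscreteTopology (PrimeSpectrum Γ(X, ⊤)))
  exact (X.isoSpec.hom.homeomorph.isEmbedding).discreteTopology

/-- A CONNECTED scheme finite over a field has exactly one point (`Subsingleton`; with the unit section it is `{e}`).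
[cite: AtiyahMacdonald1969, Prop. 8.1 and Prop. 8.3 (p. 89)] -/
theorem subsingleton_of_isFinite_of_connectedSpace {X : Scheme.{u}} (f : X ⟶ Spec (.of k)) [IsFinite f] [ConnectedSpace ↥X] :
    Subsingleton ↥X := by
  haveI := discreteTopology_of_isFinite f
  exact ⟨fun a b => (isPreconnected_univ (α := ↥X)).subsingleton (Set.mem_univ a) (Set.mem_univ b)⟩

/-! ## §2 The splitting `H ⊗ G₀ ≅ G` -/

section Splitting

variable {G G₀ H : Over (Spec (.of k))} [GrpObj G] [GrpObj G₀] [GrpObj H]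

/-- **TRIVIAL KERNEL**: with `G₀ ↪ G` the (one-point) unit component and `H ↪ G` a closed ÉTALE subgroup, if `d₁ : T → H` and `d₂ : T → G₀` have the
same image in `G` then `d₁ = 1` — the image of `d₁` lies over the unit point of `H` (`G₀` has one point, `i` is injective), so `d₁` is the unit
by B-p08's ★ `eq_toUnit_comp_of_range_subset` («a morphism into an unramified scheme landing in the unit section IS the unit section»).
[cite: Tate1997FiniteFlatGroupSchemes, (3.7)] -/
theorem eq_one_of_comp_eq_comp [IsFinite G₀.hom] [ConnectedSpace ↥G₀.left] [Etale H.hom]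
    (j : G₀ ⟶ G) [IsMonHom j] (i : H ⟶ G) [IsMonHom i] [IsClosedImmersion i.left]
    {T : Over (Spec (.of k))} (d₁ : T ⟶ H) (d₂ : T ⟶ G₀) (h : d₁ ≫ i = d₂ ≫ j) : d₁ = 1 := by
  haveI : Subsingleton ↥G₀.left := subsingleton_of_isFinite_of_connectedSpace G₀.hom
  have hrange : Set.range d₁.left ⊆ Set.range η[H].left := by
    rintro _ ⟨t, rfl⟩
    -- the point of `Spec k`
    let pt : ↥(𝟙_ (Over (Spec (.of k)))).left := (IsLocalRing.closedPoint k : PrimeSpectrum k)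
    refine ⟨pt, i.left.isClosedEmbedding.injective ?_⟩
    have e1 : i.left (η[H].left pt) = η[G].left pt := by
      rw [← Scheme.Hom.comp_apply, ← Over.comp_left, IsMonHom.one_hom]
    have e2 : i.left (d₁.left t) = j.left (d₂.left t) := by
      rw [← Scheme.Hom.comp_apply, ← Over.comp_left, h, Over.comp_left, Scheme.Hom.comp_apply]
    have e3 : d₂.left t = η[G₀].left pt := Subsingleton.elim _ _
    have e4 : j.left (η[G₀].left pt) = η[G].left pt := by
      rw [← Scheme.Hom.comp_apply, ← Over.comp_left, IsMonHom.one_hom]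
    rw [e1, e2, e3, e4]
  rw [eq_toUnit_comp_of_range_subset η[H] d₁ hrange, Hom.one_def]

/-- **AN ÉTALE CLOSED SUBGROUP OF COMPLEMENTARY RANK SPLITS OFF THE UNIT COMPONENT** ([Tate1997FiniteFlatGroupSchemes] (3.7): over a perfect
field the connected–étale sequence splits, `G = G⁰ × G_ét`).  Let `k` be a field, `G` a FINITE COMMUTATIVE group scheme over `Spec k`,
`j : G₀ ↪ G` its unit component (a homomorphism, open and closed immersion, connected source) and `i : H ↪ G` a closed subgroup scheme
which is ÉTALE over `k` with `rk H · rk G₀ = rk G` (pointwise ranks `Scheme.Hom.finrank`).  Then the multiplication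
`m = (i ⊗ j) ≫ μ_G : H ⊗ G₀ ⟶ G` is an ISOMORPHISM.  Proof: `m` is a homomorphism (`G` commutative); if `m(a) = m(b)` on `T`-points then
`i(b₁⁻¹a₁) = j(b₂a₂⁻¹)`, so `b₁⁻¹a₁ = 1` (`eq_one_of_comp_eq_comp`) and then `b₂a₂⁻¹ = 1` (`j` mono): `m` is a monomorphism; it is finite
(`H ⊗ G₀` finite, `G` separated), hence a closed immersion (Mathlib `IsClosedImmersion.iff_isFinite_and_mono`), hence an isomorphism by the rank
equality `rk (H ⊗ G₀) = rk H · rk G₀ = rk G` (★ `finrank_tensorObj_hom`, ★ `Over.isIso_of_isClosedImmersion_of_finrank_eq`; everything is flat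
over a field).  CONSUMER (P6 HEART (c3b)): `G = 𝒜_x̄[𝔴]` (rank `q²`), `G₀ = ker F` (rank `q`), `H` an étale line (rank `q`) ⇒ `H × ker F ≅ 𝒜[𝔴]`.
[cite: Tate1997FiniteFlatGroupSchemes, (3.7)] -/
theorem isIso_tensorHom_comp_mul_of_etale [IsCommMonObj G] [IsFinite G.hom] (j : G₀ ⟶ G) [IsMonHom j] [IsOpenImmersion j.left]
    [IsClosedImmersion j.left] [ConnectedSpace ↥G₀.left] (i : H ⟶ G) [IsMonHom i] [IsClosedImmersion i.left] [Etale H.hom]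
    (hrk : ∀ s, H.hom.finrank s * G₀.hom.finrank s = G.hom.finrank s) :
    IsIso ((i ⊗ₘ j) ≫ μ[G]) := by
  -- finiteness of everything over `Spec k`
  haveI : IsFinite G₀.hom := by rw [← Over.w j]; infer_instance
  haveI : IsFinite H.hom := by rw [← Over.w i]; infer_instance
  haveI : IsFinite (H ⊗ G₀).hom := by rw [Over.tensorObj_hom]; infer_instance
  -- flatness over a field
  haveI : Subsingleton ↥(Spec (.of k)) := inferInstanceAs (Subsingleton (PrimeSpectrum k))
  haveI : Flat G.hom := inferInstance
  haveI : Flat H.hom := inferInstance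
  haveI : Flat G₀.hom := inferInstance
  haveI : Flat (H ⊗ G₀).hom := inferInstance
  haveI : Mono j := Over.mono_of_mono_left _
  set m : H ⊗ G₀ ⟶ G := (i ⊗ₘ j) ≫ μ[G] with hm
  -- `m` is a monomorphism
  haveI hmono : Mono m := by
    refine ⟨fun {T} a b hab => ?_⟩
    -- coordinates
    have ha : a = lift (a ≫ fst H G₀) (a ≫ snd H G₀) := by rw [← comp_lift, lift_fst_snd, Category.comp_id]
    have hb : b = lift (b ≫ fst H G₀) (b ≫ snd H G₀) := by rw [← comp_lift, lift_fst_snd, Category.comp_id]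
    have hprod : ∀ c : T ⟶ H ⊗ G₀, c ≫ m = ((c ≫ fst H G₀) ≫ i) * ((c ≫ snd H G₀) ≫ j) := fun c => by
      conv_lhs => rw [show c = lift (c ≫ fst H G₀) (c ≫ snd H G₀) by rw [← comp_lift, lift_fst_snd, Category.comp_id]]
      rw [hm, ← Category.assoc, lift_map, Hom.mul_def]
    have hab' : ((a ≫ fst H G₀) ≫ i) * ((a ≫ snd H G₀) ≫ j) = ((b ≫ fst H G₀) ≫ i) * ((b ≫ snd H G₀) ≫ j) := by
      rw [← hprod, ← hprod]; exact hab
    -- `i (b₁⁻¹ a₁) = j (b₂ a₂⁻¹)` in the commutative group `(T ⟶ G)`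
    have hd' : ((b ≫ fst H G₀) ≫ i)⁻¹ * ((a ≫ fst H G₀) ≫ i) = ((b ≫ snd H G₀) ≫ j) * ((a ≫ snd H G₀) ≫ j)⁻¹ := by
      calc ((b ≫ fst H G₀) ≫ i)⁻¹ * ((a ≫ fst H G₀) ≫ i)
          = ((b ≫ fst H G₀) ≫ i)⁻¹ * (((a ≫ fst H G₀) ≫ i) * ((a ≫ snd H G₀) ≫ j)) * ((a ≫ snd H G₀) ≫ j)⁻¹ := by group
        _ = ((b ≫ fst H G₀) ≫ i)⁻¹ * (((b ≫ fst H G₀) ≫ i) * ((b ≫ snd H G₀) ≫ j)) * ((a ≫ snd H G₀) ≫ j)⁻¹ := by rw [hab']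
        _ = ((b ≫ snd H G₀) ≫ j) * ((a ≫ snd H G₀) ≫ j)⁻¹ := by group
    have hd : ((b ≫ fst H G₀)⁻¹ * (a ≫ fst H G₀)) ≫ i = ((b ≫ snd H G₀) * (a ≫ snd H G₀)⁻¹) ≫ j := by
      rw [MonObj.mul_comp, GrpObj.inv_comp, MonObj.mul_comp, GrpObj.inv_comp]
      exact hd'
    have h1 : (b ≫ fst H G₀)⁻¹ * (a ≫ fst H G₀) = 1 := eq_one_of_comp_eq_comp j i _ _ hd
    have hfst : a ≫ fst H G₀ = b ≫ fst H G₀ := by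
      rw [inv_mul_eq_one] at h1; exact h1.symm
    have h2 : (b ≫ snd H G₀) * (a ≫ snd H G₀)⁻¹ = 1 := by
      rw [← cancel_mono j, MonObj.one_comp, ← hd, h1, MonObj.one_comp]
    have hsnd : a ≫ snd H G₀ = b ≫ snd H G₀ := by
      rw [mul_inv_eq_one] at h2; exact h2.symm
    rw [ha, hb, hfst, hsnd]
  -- `m.left` is finite and a monomorphism, hence a closed immersion
  haveI : Mono m.left := inferInstance
  haveI : IsFinite m.left :=
    MorphismProperty.of_postcomp (W := @IsFinite) (W' := @IsSeparated) m.left G.hom inferInstance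
      (by rw [Over.w m]; infer_instance)
  haveI : IsClosedImmersion m.left := (IsClosedImmersion.iff_isFinite_and_mono m.left).mpr ⟨inferInstance, inferInstance⟩
  -- ranks: `rk (H ⊗ G₀) = rk G₀ · rk H = rk G`
  exact Literature.AlgebraicGeometry.Morphisms.Over.isIso_of_isClosedImmersion_of_finrank_eq m fun s => by
    rw [Literature.AlgebraicGeometry.Morphisms.finrank_tensorObj_hom, mul_comm, hrk s]

end Splitting

end Literature.AlgebraicGeometry.GroupSchemes

end
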